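import Literature.AnabelianGeometry.EtaleTheta.Discharge.Sec3Cor38CriterionSlice
import Literature.AnabelianGeometry.EtaleTheta.Discharge.Sec3Cor38Transport
import Literature.AlgebraicGeometry.Frobenioids.PerfectionEndomorphisms
import Literature.AlgebraicGeometry.Frobenioids.ModelFrobenioidEndMonoid
import Literature.AlgebraicGeometry.Frobenioids.ModelFrobenioidUnits
import HarnessLib

/-!
# [EtTh] Corollary 3.8 (i) sub-DAG — row C38-L05, part (c): the "O^▷-like" pre-steps of `(C^pf)^coa-pre_X` are
# exactly those whose invariant `(ψ^*)⁻¹ Div ψ` is a root of the divisor of a rational function with effective divisor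

Mochizuki, *The étale theta function …*, Publ. RIMS **45** (2009), Cor. 3.8, proof PDF p.81 l.20–27 ("pre-steps
`A' → B` that are abstractly equivalent [cf. §0] to an endomorphism that belongs to '`O^▷(−)`'", justified by
"Proposition 3.4, (ii)" and "[Mzk17], Definition 1.3, (iii), (d)") [cite: MochizukiEtTh2009, Cor 3.8 p.81];
[FrdI] Thm. 5.2 (i) p.100 (a base-identity linear endomorphism of `(A_D, α)` in a model Frobenioid is a datum
`(1, id, Div, u)` with `Div = Div_B(u)` effective) and Prop. 5.5 (i) p.104 (`O^▷((A, n)) = lim_c O^▷(A^{(c)})` in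
`C^pf`) [cite: MochizukiFrdI2008, Thm. 5.2 (i) p.100].  abc-iut cell, layer L2, seat abc-iut-w5-d124; companion of
`TemperedFrobenioidCor38Sub.lean` (p414329, plan/L2/SUBDAG-EtTh-Cor38.md row **C38-L05**, sub-row L05c of §F),
sequel of `Sec3Cor38CriterionSlice.lean`.

For a tempered Frobenioid `C` (Def. 3.6 (ii): the model Frobenioid of `(D, Φ, B, B → Φ^gp)`,
`B = B₀^Λ|_D ×_{(Φ^{ℝ-log})^gp} Φ^gp`) and THE perfection `P := PreFrobenioidData.perfection hF`:
* `TemperedFrobenioid.divO C W ⊆ Φ(W)` — the divisors `Z` with `Div Z = Div_B(u)` for some `u ∈ B(W)` (the divisors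
  of the elements of the various `O^▷(A)`, `Base A = W`, [FrdI] Thm. 5.2 (i); L1 `ModelFrobenioid.*EndSubmonoid*`),
  stable under pull-back and powers; `divOPf C W ⊆ Φ^pf(W)` — their roots `Z^{1/N}`;
* **L05c** `isOTriLikePreStep_iff_sliceDiv_mem`: an object `(Y, ψ)` of `(C^pf)^coa-pre_X` is O^▷-like
  (`IsOTriLikePreStep P ψ`: abstractly equivalent to an element of some `O^▷(A'')` of `C^pf`) iff
  `δ(Y, ψ) = (ψ^*)⁻¹ Div ψ ∈ divOPf C (Base X)`;
* hence (`isLimitOfOTriLike_iff_isLUB_divOPf`, with part (b)): print's "[filtered] projective limit" condition on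
  `ψ` ⟺ `δ(ψ)` is the supremum in `(Φ^pf(Base X), ∣)` of a nonempty directed family in `divOPf C (Base X)`.
What remains of row C38-L05 after this file is MONOID theory on the data of Def. 3.3/3.6 (i) (sub-row L05d).
Proof-only apart from the two set-builder definitions.  HONEST FRAMING: refereed pre-IUT material; nothing here
bears on [IUTchIII] Cor. 3.12.
-/

namespace Literature.AnabelianGeometry.EtaleTheta

open CategoryTheory Opposite Limits Literature.AlgebraicGeometry.Frobenioids

universe u₀ v₀ u v w

variable {D₀ : Type u₀} [Category.{v₀} D₀] {V : FrdIMonoidStub.{w}}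
  {T : RealifiedDivisorMonoids (D₀ := D₀) V} {D : Type u} [Category.{v} D] {VD : FrdICatStub.{u, v, w} D}

namespace TemperedFrobenioid

variable (C : TemperedFrobenioid T D VD)

/-! ### §1 The divisors of rational functions with effective divisor, and their roots -/

/-- `divO C W ⊆ Φ(W)`: the effective divisors `Z` at `W ∈ Ob(D)` with `Div Z = Div_B(u)` in `Φ(W)^gp` for some
`u ∈ B(W) = B₀^Λ(Y_W) ×_{(Φ^{ℝ-log})^gp} Φ^gp(W)` — by [FrdI] Thm. 5.2 (i) exactly the zero divisors of the
base-identity linear endomorphisms (the elements of `O^▷(A)`) of the objects `A = (W, α)` of the model Frobenioid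
`C` (L1 `ModelFrobenioid.exists_mem_endSubmonoid_unit_eq` / `of_div_eq_divB_unit_of_mem_endSubmonoid`).
[cite: MochizukiFrdI2008, Thm. 5.2 (i) p.100] -/
def divO (W : D) : Set (C.divisorMonoid.obj (op W)) :=
  {Z | ∃ u : C.ratFnFunctor.obj (op W),
    _root_.Literature.AlgebraicGeometry.Frobenioids.divB C.divisorMonoid C.ratFnFunctor C.divBNatTrans (op W) u =
      Algebra.GrothendieckGroup.of Z}

/-- `divOPf C W ⊆ Φ^pf(W)`: the roots `Z^{1/N}` (`N ≥ 1`) in the perfection `Φ(W)^pf` of the elements of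
`divO C W` — the invariants of the O^▷-like pre-steps of `C^pf` (this file). [cite: MochizukiEtTh2009, Cor 3.8 p.81] -/
def divOPf (W : D) : Set (Perfection (C.divisorMonoid.obj (op W))) :=
  {y | ∃ (Z : C.divisorMonoid.obj (op W)) (N : ℕ+), Z ∈ C.divO W ∧ y = Perfection.mk Z N}

variable {C}

/-- `0 ∈ divO C W` (the divisor of `1 ∈ B(W)`). [cite: MochizukiFrdI2008, Thm. 5.2 (i) p.100] -/
theorem one_mem_divO (W : D) : (1 : C.divisorMonoid.obj (op W)) ∈ C.divO W :=
  ⟨1, by rw [map_one, map_one]⟩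

/-- `divO C W` is closed under products (sums of divisors). [cite: MochizukiFrdI2008, Thm. 5.2 (i) p.100] -/
theorem mul_mem_divO {W : D} {Z Z' : C.divisorMonoid.obj (op W)} (hZ : Z ∈ C.divO W) (hZ' : Z' ∈ C.divO W) :
    Z * Z' ∈ C.divO W := by
  obtain ⟨u, hu⟩ := hZ
  obtain ⟨u', hu'⟩ := hZ'
  exact ⟨u * u', by rw [map_mul, map_mul, hu, hu']⟩

/-- `divO C W` is closed under powers. [cite: MochizukiFrdI2008, Thm. 5.2 (i) p.100] -/
theorem pow_mem_divO {W : D} {Z : C.divisorMonoid.obj (op W)} (hZ : Z ∈ C.divO W) (n : ℕ) :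
    Z ^ n ∈ C.divO W := by
  induction n with
  | zero => rw [pow_zero]; exact one_mem_divO W
  | succ n ih => rw [pow_succ]; exact mul_mem_divO ih hZ

/-- `divO C (−)` is stable under pull-back along any arrow of `D` (naturality of `Div_B : B → Φ^gp`).
[cite: MochizukiFrdI2008, Thm. 5.2 (i) p.100] -/
theorem pull_mem_divO {W W' : D} (g : W' ⟶ W) {Z : C.divisorMonoid.obj (op W)} (hZ : Z ∈ C.divO W) :
    (C.divisorMonoid.map g.op).hom Z ∈ C.divO W' := by
  obtain ⟨u, hu⟩ := hZ
  exact ⟨(C.ratFnFunctor.map g.op).hom u, (ModelFrobenioid.of_map_eq_divB_map g hu.symm).symm⟩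

/-- `divOPf C (−)` is stable under the pull-back maps `Φ^pf(g)` of the perfected divisor monoid.
[cite: MochizukiFrdI2008, Prop. 3.2 (i) p.58] -/
theorem map_pull_mem_divOPf {W W' : D} (g : W' ⟶ W) {y : Perfection (C.divisorMonoid.obj (op W))}
    (hy : y ∈ C.divOPf W) : Perfection.map (pull C.divisorMonoid g) y ∈ C.divOPf W' := by
  obtain ⟨Z, N, hZ, rfl⟩ := hy
  exact ⟨pull C.divisorMonoid g Z, N, pull_mem_divO g hZ, by rw [Perfection.map_mk]⟩

/-- The image `Z^{1/1}` of an element of `divO` lies in `divOPf`. [cite: MochizukiEtTh2009, Cor 3.8 p.81] -/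
theorem mk_one_mem_divOPf {W : D} {Z : C.divisorMonoid.obj (op W)} (hZ : Z ∈ C.divO W) :
    Perfection.mk Z 1 ∈ C.divOPf W :=
  ⟨Z, 1, hZ, rfl⟩

/-- The zero divisor of an element of `O^▷(A)` (`A` an object of the tempered Frobenioid `C`) lies in
`divO C (Base A)`. [cite: MochizukiFrdI2008, Thm. 5.2 (i) p.100] -/
theorem div_mem_divO_of_mem_endSubmonoid {A : C.category} {θ : A ⟶ A}
    (hθ : θ ∈ PreFrobenioid.endSubmonoid C.toElem A) : ModelFrobenioid.div θ ∈ C.divO A.base :=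
  ⟨ModelFrobenioid.unit θ, (ModelFrobenioid.of_div_eq_divB_unit_of_mem_endSubmonoid hθ).symm⟩

/-- Conversely every element of `divO C (Base A)` is the zero divisor of an element of `O^▷(A)`.
[cite: MochizukiFrdI2008, Thm. 5.2 (i) p.100] -/
theorem exists_mem_endSubmonoid_div_eq {A : C.category} {Z : C.divisorMonoid.obj (op A.base)}
    (hZ : Z ∈ C.divO A.base) :
    ∃ θ : A ⟶ A, θ ∈ PreFrobenioid.endSubmonoid C.toElem A ∧ ModelFrobenioid.div θ = Z := by
  obtain ⟨u, hu⟩ := hZ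
  obtain ⟨θ, hθ, -, hdiv⟩ := ModelFrobenioid.exists_mem_endSubmonoid_unit_eq A Z u hu.symm
  exact ⟨θ, hθ, hdiv⟩

end TemperedFrobenioid

namespace Cor38Criterion

open TemperedFrobenioid

variable {C : TemperedFrobenioid T D VD} {hF : PreFrobenioid.IsFrobenioid C.toElem}

/-! ### §2 Divisors of endomorphism classes of `C^pf` -/

/-- The perfected divisor of the class `[θ] : X → X` of an endomorphism `θ` of `X.obj^{(c)}`:
`((frob_{X,c})^* Div θ)^{1/(n·c)}` ([FrdI] Prop. 3.2 (i); L1 `Rep.div`). [cite: MochizukiFrdI2008, Prop. 3.2 (i) p.58] -/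
theorem div_endClass (X : (PreFrobenioidData.perfection hF).Pf) (c : ℕ+)
    (θ : PreFrobenioid.frobPow hF X.obj c ⟶ PreFrobenioid.frobPow hF X.obj c) :
    (PreFrobenioidData.perfection hF).ops.div (PreFrobenioid.Perfection.endClass X c θ) =
      Perfection.mk (pull C.divisorMonoid (PreFrobenioid.Base C.toElem (PreFrobenioid.frob hF X.obj c))
        (PreFrobenioid.Div C.toElem θ)) (X.idx * c) := rfl

/-- For a base-identity endomorphism `ε` of `C^pf`, `(ε^*)⁻¹ Div ε = Div ε`. [cite: MochizukiFrdI2008, Def. 1.3 (iii) p.24] -/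
theorem invDiv_eq_div_of_isBaseIdentity {X : (PreFrobenioidData.perfection hF).Pf} (ε : X ⟶ X)
    (hb : (PreFrobenioidData.perfection hF).ops.IsBaseIdentity ε)
    (h : PreFrobenioid.IsBaseIso (PreFrobenioidData.perfection hF).ops.toFunctor ε) :
    PreFrobenioid.invDiv (PreFrobenioidData.perfection hF).ops.toFunctor ε h =
      PreFrobenioid.Div (PreFrobenioidData.perfection hF).ops.toFunctor ε := by
  apply PreFrobenioid.Perfection.invDiv_eq_of_pull_eq
  rw [show PreFrobenioid.Base (PreFrobenioidData.perfection hF).ops.toFunctor ε = 𝟙 _ from hb, pull_id]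

/-- An element of `O^▷(X)` of `C^pf` is a co-angular pre-step into `X`. [cite: MochizukiFrdI2008, Prop. 3.2 (iii) p.59] -/
theorem isCoAngularPreStep_of_mem_endSubmonoid {X : (PreFrobenioidData.perfection hF).Pf} {ε : X ⟶ X}
    (hε : (ε : End X) ∈ (PreFrobenioidData.perfection hF).ops.endSubmonoid X) :
    (PreFrobenioidData.perfection hF).ops.IsCoAngularPreStep ε := by
  refine isCoAngularPreStep_of_isPreStep ⟨hε.2, ?_⟩
  change IsIso ((PreFrobenioidData.perfection hF).ops.base.map ε)
  rw [show (PreFrobenioidData.perfection hF).ops.base.map ε = 𝟙 _ from hε.1]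
  infer_instance

/-! ### §3 L05c: O^▷-like objects of `(C^pf)^coa-pre_X` ⟺ `δ ∈ divOPf C (Base X)` -/

/-- An isomorphism `(Y, ψ) ≅ (A, ε)` in `(C^pf)^coa-pre_X` onto an element `ε ∈ O^▷(X)` exhibits `ψ` as O^▷-like.
[cite: MochizukiEtTh2009, Cor 3.8 p.81] -/
theorem isOTriLikePreStep_of_iso_endo {X : (PreFrobenioidData.perfection hF).Pf}
    (U : CoaPreOver (PreFrobenioidData.perfection hF) X) {ε : X ⟶ X}
    (hε : (ε : End X) ∈ (PreFrobenioidData.perfection hF).ops.endSubmonoid X)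
    (hεc : (PreFrobenioidData.perfection hF).ops.IsCoAngularPreStep ε)
    (i : U ≅ (⟨Over.mk ε, hεc⟩ : CoaPreOver (PreFrobenioidData.perfection hF) X)) :
    IsOTriLikePreStep (PreFrobenioidData.perfection hF) U.obj.hom := by
  refine ⟨U.property, X, ε, hε, ⟨?_⟩⟩
  let eL : U.obj.left ≅ X :=
    ⟨i.hom.hom.left, i.inv.hom.left, congrArg (fun t => t.hom.left) i.hom_inv_id,
      congrArg (fun t => t.hom.left) i.inv_hom_id⟩
  refine Arrow.isoMk' U.obj.hom ε eL (Iso.refl X) ?_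
  rw [Iso.refl_hom, Category.comp_id]
  exact Over.w i.hom.hom

/-- **L05c, (⇐)**: if `δ(Y, ψ) ∈ divOPf C (Base X)`, then `ψ` is O^▷-like — `δ(Y, ψ) = Z^{1/N}` with
`Div Z = Div_B(u)`; the class `ε := [θ]` of the endomorphism `θ = (1, id, (frob^*)⁻¹ Zⁿ, ·)` of `X.obj^{(N)}` lies in
`O^▷(X)` with `Div ε = Z^{1/N}`, and `(Y, ψ) ≅ (X, ε)` over `X` by part (a). [cite: MochizukiEtTh2009, Cor 3.8 p.81] -/
theorem isOTriLikePreStep_of_sliceDiv_mem {X : (PreFrobenioidData.perfection hF).Pf}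
    (U : CoaPreOver (PreFrobenioidData.perfection hF) X) (hU : sliceDiv hF U ∈ C.divOPf X.obj.base) :
    IsOTriLikePreStep (PreFrobenioidData.perfection hF) U.obj.hom := by
  obtain ⟨Z, N, hZ, hδ⟩ := hU
  -- the endomorphism `θ` of `X.obj^{(N)}` with divisor `(frob^*)⁻¹ (Z ^ n)`, `n = X.idx`
  haveI := PreFrobenioid.isIso_base_frob hF X.obj N
  set Z₁ : C.divisorMonoid.obj (op (PreFrobenioid.frobPow hF X.obj N).base) :=
    pull C.divisorMonoid (inv (PreFrobenioid.Base C.toElem (PreFrobenioid.frob hF X.obj N))) (Z ^ (X.idx : ℕ))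
    with hZ₁
  have hZ₁mem : Z₁ ∈ C.divO (PreFrobenioid.frobPow hF X.obj N).base := pull_mem_divO _ (pow_mem_divO hZ _)
  obtain ⟨θ, hθ, hθdiv⟩ := exists_mem_endSubmonoid_div_eq hZ₁mem
  -- its class `ε = [θ] ∈ O^▷(X)`
  let ε : X ⟶ X := PreFrobenioid.Perfection.endClass X N θ
  have hε : (ε : End X) ∈ (PreFrobenioidData.perfection hF).ops.endSubmonoid X :=
    (PreFrobenioid.Perfection.endClassHom_mem_iff X N (End.of θ)).2 hθ
  have hεc := isCoAngularPreStep_of_mem_endSubmonoid hε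
  -- `Div ε = Z^{1/N}`
  have hdivε : (PreFrobenioidData.perfection hF).ops.div ε = Perfection.mk Z N := by
    have h1 := div_endClass X N θ
    have h2 : pull C.divisorMonoid (PreFrobenioid.Base C.toElem (PreFrobenioid.frob hF X.obj N))
        (PreFrobenioid.Div C.toElem θ) = Z ^ (X.idx : ℕ) := by
      rw [show PreFrobenioid.Div C.toElem θ = Z₁ from hθdiv, hZ₁, PreFrobenioid.pull_pull_inv_eq]
    rw [h2, mul_comm X.idx N] at h1
    exact h1.trans (Perfection.mk_pow_mul Z N X.idx)
  have hδε : sliceDiv hF (⟨Over.mk ε, hεc⟩ : CoaPreOver (PreFrobenioidData.perfection hF) X) = sliceDiv hF U := by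
    rw [hδ, sliceDiv_mk, invDiv_eq_div_of_isBaseIdentity ε hε.1]
    exact hdivε
  -- `(Y, ψ) ≅ (X, ε)` in the thin category
  obtain ⟨a⟩ := nonempty_hom_of_sliceDiv_dvd (U := U) (U' := ⟨Over.mk ε, hεc⟩) (by rw [hδε])
  obtain ⟨b⟩ := nonempty_hom_of_sliceDiv_dvd (U := ⟨Over.mk ε, hεc⟩) (U' := U) (by rw [hδε])
  exact isOTriLikePreStep_of_iso_endo U hε hεc
    ⟨a, b, (subsingleton_hom _ _).elim _ _, (subsingleton_hom _ _).elim _ _⟩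

/-- **L05c, (⇒)**: the invariant `δ(Y, ψ)` of an O^▷-like object of `(C^pf)^coa-pre_X` lies in `divOPf C (Base X)`:
`ψ ≅ ε` with `ε = [θ] ∈ O^▷(A'')`, `θ ∈ O^▷(A''.obj^{(c)})`, so `δ(Y, ψ) = (Base r)^* Div ε =
(Base r)^*((frob^* Div θ)^{1/(n·c)})` for the isomorphism `r : X ≅ A''`, and `Div θ = Div_B(u_θ)`.
[cite: MochizukiEtTh2009, Cor 3.8 p.81] -/
theorem sliceDiv_mem_of_isOTriLikePreStep {X : (PreFrobenioidData.perfection hF).Pf}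
    (U : CoaPreOver (PreFrobenioidData.perfection hF) X)
    (hU : IsOTriLikePreStep (PreFrobenioidData.perfection hF) U.obj.hom) :
    sliceDiv hF U ∈ C.divOPf X.obj.base := by
  obtain ⟨hcoa, A'', ε, hε, ⟨e⟩⟩ := hU
  obtain ⟨c, θ, hθ, hθε⟩ := PreFrobenioid.Perfection.exists_endClassHom_eq_of_mem A'' hε
  -- the isomorphisms of the arrow isomorphism `ψ ≅ ε`
  let l : U.obj.left ≅ A'' := ⟨e.hom.left, e.inv.left, Arrow.hom_inv_id_left e, Arrow.inv_hom_id_left e⟩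
  let r : X ≅ A'' := ⟨e.hom.right, e.inv.right, Arrow.hom_inv_id_right e, Arrow.inv_hom_id_right e⟩
  have hw : l.hom ≫ ε = U.obj.hom ≫ r.hom := Arrow.w e.hom
  haveI : IsIso r.inv := ⟨⟨r.hom, r.inv_hom_id, r.hom_inv_id⟩⟩
  -- `(Y, ψ) ≅ (A'', ε ≫ r⁻¹)` over `X`
  have hεc : (PreFrobenioidData.perfection hF).ops.IsCoAngularPreStep (ε ≫ r.inv) :=
    Cor38Transport.isCoAngularPreStep_comp_iso _ (isCoAngularPreStep_of_mem_endSubmonoid hε) r.inv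
  have hw' : l.hom ≫ (ε ≫ r.inv) = U.obj.hom := by
    rw [← Category.assoc, hw, Category.assoc, r.hom_inv_id, Category.comp_id]
  let i : U ≅ (⟨Over.mk (ε ≫ r.inv), hεc⟩ : CoaPreOver (PreFrobenioidData.perfection hF) X) :=
    (ObjectProperty.fullyFaithfulι _).preimageIso (Over.isoMk l hw')
  rw [sliceDiv_eq_of_iso i, sliceDiv_mk]
  -- compute `((ε ≫ r⁻¹)^*)⁻¹ Div (ε ≫ r⁻¹) = (Base r)^* Div ε`
  have hεpre : PreFrobenioid.IsPreStep (PreFrobenioidData.perfection hF).ops.toFunctor ε :=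
    (isCoAngularPreStep_of_mem_endSubmonoid hε).2
  have hrpre : PreFrobenioid.IsPreStep (PreFrobenioidData.perfection hF).ops.toFunctor r.inv :=
    PreFrobenioid.isPreStep_of_isIso _ r.inv
  have key := PreFrobenioid.pull_invDiv_comp (PreFrobenioidData.perfection hF).ops.toFunctor ε r.inv
    hεpre.2 hrpre hεc.2.2
  rw [show PreFrobenioid.Div (PreFrobenioidData.perfection hF).ops.toFunctor r.inv = 1 from
      PreFrobenioid.isIsometry_of_isIso (PreFrobenioidData.perfection hF).ops.toFunctor
        (PreFrobenioid.Perfection.isPreFrobenioid_perfection (hF := hF)) r.inv,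
    one_mul, invDiv_eq_div_of_isBaseIdentity ε hε.1] at key
  haveI : IsIso (PreFrobenioid.Base (PreFrobenioidData.perfection hF).ops.toFunctor r.inv) := hrpre.2
  have key2 : PreFrobenioid.invDiv (PreFrobenioidData.perfection hF).ops.toFunctor (ε ≫ r.inv) hεc.2.2 =
      pull (PreFrobenioidData.perfection hF).ops.monFunctor
        (inv (PreFrobenioid.Base (PreFrobenioidData.perfection hF).ops.toFunctor r.inv))
        (PreFrobenioid.Div (PreFrobenioidData.perfection hF).ops.toFunctor ε) := by
    rw [← key, PreFrobenioid.pull_inv_pull_eq]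
  rw [key2]
  -- `Div ε = (frob^* Div θ)^{1/(n·c)}` with `Div θ ∈ divO`, then pull back
  have hdivε : PreFrobenioid.Div (PreFrobenioidData.perfection hF).ops.toFunctor ε =
      Perfection.mk (pull C.divisorMonoid (PreFrobenioid.Base C.toElem (PreFrobenioid.frob hF A''.obj c))
        (PreFrobenioid.Div C.toElem (End.asHom θ))) (A''.idx * c) := by
    rw [show ε = PreFrobenioid.Perfection.endClass A'' c (End.asHom θ) from hθε.symm]
    exact div_endClass A'' c (End.asHom θ)
  rw [hdivε]
  exact map_pull_mem_divOPf _ (map_pull_mem_divOPf _ ⟨_, _, div_mem_divO_of_mem_endSubmonoid hθ, rfl⟩)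

/-- **L05c**: an object `(Y, ψ)` of `(C^pf)^coa-pre_X` is O^▷-like iff `δ(Y, ψ) ∈ divOPf C (Base X)`.
[cite: MochizukiEtTh2009, Cor 3.8 p.81] -/
theorem isOTriLikePreStep_iff_sliceDiv_mem {X : (PreFrobenioidData.perfection hF).Pf}
    (U : CoaPreOver (PreFrobenioidData.perfection hF) X) :
    IsOTriLikePreStep (PreFrobenioidData.perfection hF) U.obj.hom ↔ sliceDiv hF U ∈ C.divOPf X.obj.base :=
  ⟨sliceDiv_mem_of_isOTriLikePreStep U, isOTriLikePreStep_of_sliceDiv_mem U⟩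

/-! ### §4 Parts (a)–(c) together: the limit condition as a supremum of elements of `divOPf` -/

/-- **L05a–c**: for a co-angular pre-step `ψ : Y → X` of `C^pf`, print's condition "`ψ` may be written as a
[filtered] projective limit in `(C^pf)^coa-pre_X` of pre-steps abstractly equivalent to an endomorphism that
belongs to `O^▷(−)`" holds iff `δ(ψ) = (ψ^*)⁻¹ Div ψ` is the supremum, for divisibility in `Φ^pf(Base X)`, of a
nonempty directed family of elements of `divOPf C (Base X)` dividing `δ(ψ)`. [cite: MochizukiEtTh2009, Cor 3.8 p.81] -/
theorem isLimitOfOTriLike_iff_isLUB_divOPf {X Y : (PreFrobenioidData.perfection hF).Pf} (ψ : Y ⟶ X)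
    (hψ : (PreFrobenioidData.perfection hF).ops.IsCoAngularPreStep ψ) :
    IsLimitOfOTriLike (PreFrobenioidData.perfection hF) ψ ↔
      ∃ S : Set (Perfection (C.divisorMonoid.obj (op X.obj.base))),
        S ⊆ C.divOPf X.obj.base ∧ S.Nonempty ∧ DirectedOn (fun a b => a ∣ b) S ∧
        (∀ s ∈ S, s ∣ sliceDiv hF ⟨Over.mk ψ, hψ⟩) ∧
        ∀ z, (∀ s ∈ S, s ∣ z) → sliceDiv hF ⟨Over.mk ψ, hψ⟩ ∣ z := by
  rw [isLimitOfOTriLike_iff_isLUB ψ hψ]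
  refine exists_congr fun S => and_congr_left fun _ => ⟨fun h s hs => ?_, fun h s hs => ?_⟩
  · obtain ⟨U, hU, rfl⟩ := h s hs
    exact sliceDiv_mem_of_isOTriLikePreStep U hU
  · obtain ⟨U, rfl⟩ := exists_sliceDiv_eq X s
    exact ⟨U, isOTriLikePreStep_of_sliceDiv_mem U (h hs), rfl⟩

end Cor38Criterion

end Literature.AnabelianGeometry.EtaleTheta
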